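import Literature.AlgebraicTopology.SingularHomology.HomologySelfMapFixingOpenSet
import HarnessLib

/-!
# Localisation of the homology action of a self-map supported in TWO disjoint local pieces (variation at two singular points;
# AGZV II §1.1, Hatcher §2.1)

Layer `Literature/AlgebraicTopology/SingularHomology`. Written by the prover seat `hodge-nonav-prover-Ax` (g18): the model-independent
homological skeleton of brick L6-4 «LOCALISATION ×2» of the LOC6 plan for crux K1Q `VeryGeneralQuaternionCommutatorsInHg` (route
`Summits/HodgeConjecture/HodgeConjecture/Theses/Q8SymplecticPowers.lean`, stub S5): the geometric monodromy `h` of a d6 meridian is the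
identity off two disjoint balls `A₁ ∋ p`, `A₂ ∋ σp`, preserves each, and on the homology of the ball pieces acts as the deck rotation `τ`
(at `p`, Kummer exponent `i`) resp. as `τ⁻¹` (at `σp`, exponent `i³`). Sequel of `HomologySelfMapFixingOpenSet` (ONE local piece:
`h_* x − x ∈ im Hₙ(A)` by excision, no hypothesis on the overlap).

**Setting.** `X = A₁ ∪ A₂ ∪ B` with `A₁, A₂, B` open, `A₁ ∩ A₂ = ∅`; `h : X → X` continuous, `h = id` on `B`, `h(A_k) ⊆ A_k`.

**Results** (coefficients: any commutative ring `R`, module `M`):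
* `piecewiseSelf A h` — the self-map equal to `h` on `A` and to the identity elsewhere (continuous as soon as `h = id` on the frontier
  of `A`, which here lies in `B`: `eq_self_of_mem_frontier`); `h = h_{A₁} ∘ h_{A₂}` (`eq_piecewiseSelf_comp_piecewiseSelf`).
* **`map_sub_self_mem_sup_range_of_eqOn₂`** — `h_* x − x ∈ im Hₙ(A₁) + im Hₙ(A₂)` for every `x ∈ Hₙ(X; M)`: the variation is the
  sum of the two local variations.
* `map_eq_map_of_restrict_eq` ∕ `map_map_eq_self_of_restrict_eq` — if the restrictions `h|_A`, `τ|_A` of two self-maps preserving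
  `A` induce the same map on `Hₙ(A)` (resp. `(h|_A)_* (τ|_A)_* = id`), then `h_* = τ_*` (resp. `h_* τ_* = id`) on `im Hₙ(A)`.
* `map_mem_range_of_restrict` — `im Hₙ(A)` is stable under every self-map preserving `A`; `finrank_range_map_subsetIncl_le` — its
  rank is at most `dim Hₙ(A)`.

## References

* [HatcherAT2002] A. Hatcher, Algebraic Topology, CUP 2002, §2.1 Thm. 2.13 ff. (exact sequence of the pair), Thm. 2.20 (excision).
* [ArnoldGuseinzadeVarchenko2012] V. I. Arnold, S. M. Gusein-Zade, A. N. Varchenko, Singularities of Differentiable Maps, Vol. 2,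
  Part I §1.1 (the monodromy is the identity off the balls; the variation operator is local; held text p0013, p0025).
-/

noncomputable section

open CategoryTheory Limits Set

universe u v

namespace Literature.AlgebraicTopology.SingularHomology

variable (R : Type v) [CommRing R] (M : Type v) [AddCommGroup M] [Module R M]
  {X : Type u} [TopologicalSpace X]

namespace singularHomology

/-! ### Splitting a self-map supported in two disjoint pieces -/

section Piecewise

/-- For `A, C` open and disjoint with `A ∪ C ∪ B = X` and `h = id` on `B`: `h` fixes the frontier of `A` (which lies in `B`).
[cite: HatcherAT2002, §2.1] -/
theorem eq_self_of_mem_frontier {A C B : Set X} (hAo : IsOpen A) (hCo : IsOpen C) (hcov : A ∪ C ∪ B = univ)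
    (hdisj : Disjoint A C) (h : C(X, X)) (hB : ∀ x ∈ B, h x = x) : ∀ a ∈ frontier A, h a = a := by
  intro a ha
  rw [hAo.frontier_eq] at ha
  obtain ⟨hacl, haA⟩ := ha
  have haC : a ∉ C := fun haC => Set.disjoint_left.1 (hdisj.closure_left hCo) hacl haC
  have haB : a ∈ B := by
    have hu : a ∈ A ∪ C ∪ B := by rw [hcov]; exact mem_univ a
    rcases hu with (h1 | h2) | h3
    · exact absurd h1 haA
    · exact absurd h2 haC
    · exact h3
  exact hB a haB

/-- **The self-map `h_A`**: `h` on `A`, the identity elsewhere — continuous when `h` fixes the frontier of `A` (pasting).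
[cite: HatcherAT2002, §2.1] -/
def piecewiseSelf (A : Set X) (h : C(X, X)) (hfr : ∀ a ∈ frontier A, h a = a) : C(X, X) :=
  haveI : ∀ x, Decidable (x ∈ A) := fun _ => Classical.dec _
  ⟨A.piecewise h id, h.continuous.piecewise (fun a ha => hfr a ha) continuous_id⟩

/-- `h_A = h` on `A`. [cite: HatcherAT2002, §2.1] -/
theorem piecewiseSelf_apply_of_mem {A : Set X} (h : C(X, X)) (hfr : ∀ a ∈ frontier A, h a = a) {a : X} (ha : a ∈ A) :
    piecewiseSelf A h hfr a = h a := by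
  classical
  show A.piecewise h id a = h a
  convert Set.piecewise_eq_of_mem A (⇑h) id ha

/-- `h_A = id` off `A`. [cite: HatcherAT2002, §2.1] -/
theorem piecewiseSelf_apply_of_not_mem {A : Set X} (h : C(X, X)) (hfr : ∀ a ∈ frontier A, h a = a) {a : X} (ha : a ∉ A) :
    piecewiseSelf A h hfr a = a := by
  classical
  show A.piecewise h id a = a
  exact (Set.piecewise_eq_of_notMem A (⇑h) id ha).trans rfl

/-- `h_A` preserves `A` when `h` does. [cite: HatcherAT2002, §2.1] -/
theorem mapsTo_piecewiseSelf {A : Set X} (h : C(X, X)) (hfr : ∀ a ∈ frontier A, h a = a) (hA : MapsTo h A A) :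
    MapsTo (piecewiseSelf A h hfr) A A := fun a ha => by
  rw [piecewiseSelf_apply_of_mem h hfr ha]; exact hA ha

/-- `h_A` fixes every point outside `A` and every point of `B` (where `h = id`). [cite: HatcherAT2002, §2.1] -/
theorem piecewiseSelf_apply_eq_self {A B : Set X} (h : C(X, X)) (hfr : ∀ a ∈ frontier A, h a = a) (hB : ∀ x ∈ B, h x = x)
    {a : X} (ha : a ∈ Aᶜ ∪ B) : piecewiseSelf A h hfr a = a := by
  by_cases haA : a ∈ A
  · rw [piecewiseSelf_apply_of_mem h hfr haA]
    rcases ha with h1 | h2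
    · exact absurd haA h1
    · exact hB a h2
  · exact piecewiseSelf_apply_of_not_mem h hfr haA

/-- **`h = h_{A₁} ∘ h_{A₂}`** for `h` supported in the disjoint open pieces `A₁, A₂` (`h = id` on `B`, `A₁ ∪ A₂ ∪ B = X`, `h(A₂) ⊆ A₂`).
[cite: ArnoldGuseinzadeVarchenko2012, Part I §1.1 (held text p0013)] -/
theorem eq_piecewiseSelf_comp_piecewiseSelf {A₁ A₂ B : Set X} (hcov : A₁ ∪ A₂ ∪ B = univ) (hdisj : Disjoint A₁ A₂) (h : C(X, X))
    (hB : ∀ x ∈ B, h x = x) (hA₂ : MapsTo h A₂ A₂) (hfr₁ : ∀ a ∈ frontier A₁, h a = a) (hfr₂ : ∀ a ∈ frontier A₂, h a = a) :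
    h = (piecewiseSelf A₁ h hfr₁).comp (piecewiseSelf A₂ h hfr₂) := by
  ext a
  rw [ContinuousMap.comp_apply]
  by_cases ha1 : a ∈ A₁
  · have ha2 : a ∉ A₂ := fun ha2 => Set.disjoint_left.1 hdisj ha1 ha2
    rw [piecewiseSelf_apply_of_not_mem h hfr₂ ha2, piecewiseSelf_apply_of_mem h hfr₁ ha1]
  · by_cases ha2 : a ∈ A₂
    · have hha : h a ∉ A₁ := fun hha => Set.disjoint_left.1 hdisj hha (hA₂ ha2)
      rw [piecewiseSelf_apply_of_mem h hfr₂ ha2, piecewiseSelf_apply_of_not_mem h hfr₁ hha]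
    · have haB : a ∈ B := by
        have hu : a ∈ A₁ ∪ A₂ ∪ B := by rw [hcov]; exact mem_univ a
        rcases hu with (h1 | h2) | h3
        · exact absurd h1 ha1
        · exact absurd h2 ha2
        · exact h3
      rw [piecewiseSelf_apply_of_not_mem h hfr₂ ha2, piecewiseSelf_apply_of_not_mem h hfr₁ ha1, hB a haB]

end Piecewise

/-! ### The variation is the sum of the two local variations -/

/-- **`h_* x − x ∈ im Hₙ(A₁) + im Hₙ(A₂)`** for a self-map `h` of `X = A₁ ∪ A₂ ∪ B` (`A₁, A₂, B` open, `A₁ ∩ A₂ = ∅`) which is the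
identity on `B` and preserves `A₁` and `A₂`: write `h = h_{A₁} ∘ h_{A₂}` and apply the one-piece localisation
(`map_sub_self_mem_range_of_eqOn`) to `h_{A₁}` (identity on `A₂ ∪ B`) and `h_{A₂}` (identity on `A₁ ∪ B`).
[cite: HatcherAT2002, §2.1 Thm. 2.13 ff. and Thm. 2.20] [cite: ArnoldGuseinzadeVarchenko2012, Part I §1.1 (held text p0013, p0025)] -/
theorem map_sub_self_mem_sup_range_of_eqOn₂ {A₁ A₂ B : Set X} (h1o : IsOpen A₁) (h2o : IsOpen A₂) (hBo : IsOpen B)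
    (hcov : A₁ ∪ A₂ ∪ B = univ) (hdisj : Disjoint A₁ A₂) (h : C(X, X)) (hB : ∀ x ∈ B, h x = x) (hA₁ : MapsTo h A₁ A₁)
    (hA₂ : MapsTo h A₂ A₂) (n : ℕ) (x : singularHomology R M X n) :
    map R M h n x - x ∈
      LinearMap.range (map R M (subsetIncl A₁) n).hom ⊔ LinearMap.range (map R M (subsetIncl A₂) n).hom := by
  have hcov' : A₂ ∪ A₁ ∪ B = univ := by rw [union_comm A₂ A₁]; exact hcov
  have hfr₁ : ∀ a ∈ frontier A₁, h a = a := eq_self_of_mem_frontier h1o h2o hcov hdisj h hB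
  have hfr₂ : ∀ a ∈ frontier A₂, h a = a := eq_self_of_mem_frontier h2o h1o hcov' hdisj.symm h hB
  -- the one-piece localisation for `h_{A₁}` (cover `A₁ ∪ (A₂ ∪ B)`) and `h_{A₂}` (cover `A₂ ∪ (A₁ ∪ B)`)
  have hv₁ : ∀ y : singularHomology R M X n, map R M (piecewiseSelf A₁ h hfr₁) n y - y ∈
      LinearMap.range (map R M (subsetIncl A₁) n).hom := fun y =>
    map_sub_self_mem_range_of_eqOn R M h1o (h2o.union hBo) (by rw [← union_assoc]; exact hcov) _
      (fun a ha => piecewiseSelf_apply_eq_self h hfr₁ hB (by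
        rcases ha with h2 | h3
        · exact Or.inl fun h1 => Set.disjoint_left.1 hdisj h1 h2
        · exact Or.inr h3))
      (mapsTo_piecewiseSelf h hfr₁ hA₁) n y
  have hv₂ : ∀ y : singularHomology R M X n, map R M (piecewiseSelf A₂ h hfr₂) n y - y ∈
      LinearMap.range (map R M (subsetIncl A₂) n).hom := fun y =>
    map_sub_self_mem_range_of_eqOn R M h2o (h1o.union hBo) (by rw [← union_assoc]; exact hcov') _
      (fun a ha => piecewiseSelf_apply_eq_self h hfr₂ hB (by
        rcases ha with h1 | h3
        · exact Or.inl fun h2 => Set.disjoint_left.1 hdisj h1 h2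
        · exact Or.inr h3))
      (mapsTo_piecewiseSelf h hfr₂ hA₂) n y
  -- `h_* x = h_{A₁*} (h_{A₂*} x)`
  have key : map R M h n x = map R M (piecewiseSelf A₁ h hfr₁) n (map R M (piecewiseSelf A₂ h hfr₂) n x) := by
    have e := congrArg (fun f : C(X, X) => map R M f n x) (eq_piecewiseSelf_comp_piecewiseSelf hcov hdisj h hB hA₂ hfr₁ hfr₂)
    simp only at e
    rw [e, map_comp, ModuleCat.comp_apply]
  have hsplit : map R M h n x - x =
      (map R M (piecewiseSelf A₁ h hfr₁) n (map R M (piecewiseSelf A₂ h hfr₂) n x) - map R M (piecewiseSelf A₂ h hfr₂) n x) +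
        (map R M (piecewiseSelf A₂ h hfr₂) n x - x) := by
    rw [key]; abel
  rw [hsplit]
  exact Submodule.add_mem_sup (hv₁ _) (hv₂ _)

/-! ### The action on the local images -/

/-- **`h_* = τ_*` on `im Hₙ(A)`** when the restrictions `h|_A, τ|_A` of two self-maps preserving `A` induce the same map on `Hₙ(A)`.
[cite: HatcherAT2002, §2.1] -/
theorem map_eq_map_of_restrict_eq {A : Set X} (h τ : C(X, X)) (hA τA : C(↥A, ↥A)) (hhA : ∀ a : ↥A, ((hA a : ↥A) : X) = h a)
    (hτA : ∀ a : ↥A, ((τA a : ↥A) : X) = τ a) (n : ℕ)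
    (hloc : ∀ a : singularHomology R M (↥A) n, map R M hA n a = map R M τA n a) :
    ∀ v ∈ LinearMap.range (map R M (subsetIncl A) n).hom, map R M h n v = map R M τ n v := by
  rintro _ ⟨a, rfl⟩
  change map R M h n (map R M (subsetIncl A) n a) = map R M τ n (map R M (subsetIncl A) n a)
  rw [map_map_subsetIncl R M h hA hhA, map_map_subsetIncl R M τ τA hτA, hloc]

/-- **`h_* τ_* = id` on `im Hₙ(A)`** when `(h|_A)_* (τ|_A)_* = id` on `Hₙ(A)` (the piece where `h` acts as `τ⁻¹`).
[cite: HatcherAT2002, §2.1] -/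
theorem map_map_eq_self_of_restrict_eq {A : Set X} (h τ : C(X, X)) (hA τA : C(↥A, ↥A)) (hhA : ∀ a : ↥A, ((hA a : ↥A) : X) = h a)
    (hτA : ∀ a : ↥A, ((τA a : ↥A) : X) = τ a) (n : ℕ)
    (hloc : ∀ a : singularHomology R M (↥A) n, map R M hA n (map R M τA n a) = a) :
    ∀ v ∈ LinearMap.range (map R M (subsetIncl A) n).hom, map R M h n (map R M τ n v) = v := by
  rintro _ ⟨a, rfl⟩
  change map R M h n (map R M τ n (map R M (subsetIncl A) n a)) = map R M (subsetIncl A) n a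
  rw [map_map_subsetIncl R M τ τA hτA, map_map_subsetIncl R M h hA hhA, hloc]

/-- `im Hₙ(A)` is stable under every self-map `g` preserving `A`. [cite: HatcherAT2002, §2.1] -/
theorem map_mem_range_of_restrict {A : Set X} (g : C(X, X)) (gA : C(↥A, ↥A)) (hgA : ∀ a : ↥A, ((gA a : ↥A) : X) = g a) (n : ℕ) :
    ∀ v ∈ LinearMap.range (map R M (subsetIncl A) n).hom, map R M g n v ∈ LinearMap.range (map R M (subsetIncl A) n).hom := by
  rintro _ ⟨a, rfl⟩
  refine ⟨map R M gA n a, ?_⟩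
  change map R M (subsetIncl A) n (map R M gA n a) = map R M g n (map R M (subsetIncl A) n a)
  rw [map_map_subsetIncl R M g gA hgA]

/-- The restriction of a self-map preserving `A`, as a self-map of `↥A`. [cite: HatcherAT2002, §2.1] -/
def restrictSelf {A : Set X} (g : C(X, X)) (hg : MapsTo g A A) : C(↥A, ↥A) :=
  ⟨hg.restrict g A A, (g.continuous.comp continuous_subtype_val).subtype_mk _⟩

/-- `restrictSelf` on points. [cite: HatcherAT2002, §2.1] -/
@[simp] theorem restrictSelf_apply_coe {A : Set X} (g : C(X, X)) (hg : MapsTo g A A) (a : ↥A) :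
    ((restrictSelf g hg a : ↥A) : X) = g a := rfl

/-- `rank im Hₙ(A) ≤ dim Hₙ(A)`. [cite: HatcherAT2002, §2.1] -/
theorem finrank_range_map_subsetIncl_le [Nontrivial R] {A : Set X} (n : ℕ) [Module.Finite R (singularHomology R M (↥A) n)] :
    Module.finrank R ↥(LinearMap.range (map R M (subsetIncl A) n).hom) ≤ Module.finrank R (singularHomology R M (↥A) n) :=
  LinearMap.finrank_range_le _

end singularHomology

end Literature.AlgebraicTopology.SingularHomology

end
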